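import Summits.QuantumFields.BalabanUV.Gaps.CapTailSigns
import Summits.QuantumFields.BalabanUV.Gaps.CapSignsNecessary

/-!
# Gaps / CapTailLimitNecessary — what [I] Theorem 2 AS PRINTED forces on the TAIL of the one-loop coefficients under the tree's tail sockets
# (rate ∕ contraction ∕ monotone): a POSITIVE limit value and an EVENTUAL FLOOR; and, on the limit-form road off the boundary,
# (0.31) ⟺ the CAP sign list (cell pub-balaban-gaps, seat g1-p3 gen 3, CAP+tail «split ∕ weakening» charge; third file of the necessity trilogy
# `Gaps/CapSignsNecessary` (N1)(N2) ∕ `Gaps/CapFloorNotNecessary` (sharpness) ∕ this one (tail side))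

HONEST FRAMING (cell rule, page 1 of everything): bookkeeping over the β sub-cell's hypothesis carriers; NOTHING of Bałaban's is asserted beyond
print; [Balaban1987RG1] Thm 2 is UNPROVED IN PRINT and enters only as the HYPOTHESIS `B12.Thm2Printed C L` of necessity statements; the tail
sockets (`Beta.RateCertificate.GeomRate` = `LimitForm.conv`, `Summit.QuantumFields.BalabanUV.Beta.CapRowsTail.{MonotoneTailUp, MonotoneTailDown, ContractingTail}`) are
HYPOTHESIS SHAPES whose producers (b2b rows G-an2-4 ∕ (CONV-C) ∕ asym1 ∕ gan24-p4) are OPEN; 0 binders discharged; NOT `BetaPertH`, NOT the continuum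
limit, NOT Clay.  HONEST DEPENDENCY (b2b cell, verbatim): «continuum YM on T⁴ ⇐ BetaPertH ∧ nine spine estimates (0/9 proved); BetaPertH ⇐ (D1) ∧
(D4) ∧ CAP+tail; G-an2-4 gates asym, D1 and NE2/3/4.»

CONTEXT.  `Gaps/CapSignsNecessary` proves that [I] Thm 2 as printed forces (N1) `0 ≤ β⁰_{k+1}` (all `k`) and (N2) positive long-window means
`c·n − A ≤ Σ_{j∈[k,k+n)} β⁰_{j+1}` on the every-slope road; `Gaps/CapFloorNotNecessary` shows a FLOOR of `β⁰` is not necessary in general (an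
oscillating `β⁰` with positive remainder passes).  The companions' sufficient roads, however, all carry a TAIL SOCKET that excludes oscillation.
This file records what (N2) gives THROUGH each socket:
§1 (pure) `le_of_windowSum_lower_eventualUpper` — window means `≥ c` eventually dominated by `binf + dθ^{j−k₀}` force `c ≤ binf`; rate-free
   `le_lim_of_windowSum_lower_tendsto` (Cesàro);
   `eventualFloor_of_syndetic_monotoneTailDown ∕ Up` — syndetic positivity + an eventually monotone tail ⟹ an EVENTUAL FLOOR.
§2 (construction level, every-slope road, `L > 1`, forward-generated ∕ halting ∕ curried) `binf_pos_of_thm2Printed_geomRate` — under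
   `GeomRate β⁰ binf c₀ θ` (`0 ≤ θ < 1`), Thm 2 as printed forces `0 < binf`: the field `binf_pos` of
   `Beta.Assembly.LimitForm` is NECESSARY, a certified `β⁰_∞ ≤ 0` would refute (0.31); `eventualFloor_of_thm2Printed_geomRate` ∕ `_tendsto` (RATE-FREE:
   mere convergence of `β⁰`, via Cesàro means) ∕ `_contractingTail` ∕ `_monotoneTailDown` ∕ `_monotoneTailUp` — under ANY of the tree's tail sockets, or
   mere convergence, Thm 2 as printed forces an EVENTUAL positive FLOOR of `β⁰` (so with a socket the necessary and sufficient tail currencies of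
   `Gaps/CapTailFloors` MEET: eventual floor; the oscillating witness of `Gaps/CapFloorNotNecessary` lives exactly in the non-convergent gap).
§3 `thm2Printed_iff_signs_of_limitForm` — ON THE LIMIT-FORM ROAD, OFF THE BOUNDARY (`β⁰_{k+1} ≠ 0` for `k < k₀`, a measure-zero exclusion for
   certified numerics): `B12.Thm2Printed C L ↔ ∀ k < k₀, 0 < β⁰_{k+1}` — [I] Theorem 2 as printed IS the CAP sign list, given the tail
   (`→` = (N1) of `CapSignsNecessary`; `←` = gen 0's `CapTailSigns.thm2Printed_of_signs`).  The exact residue of the (0.31) row on this road.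
§4 `thm2Printed_iff_allSigns_and_limit_pos` — RATE-FREE: under mere convergence of `β⁰` + `EverySlope` + (C) + (U), off the boundary,
   `B12.Thm2Printed C L ↔ (∀ k, 0 < β⁰_{k+1}) ∧ 0 < β⁰_∞` (`←` via `floor_of_allSigns_tendsto` + gen 2's `thm2Printed_of_beta0Floor_everySlope`).
All [folklore] real-sequence bookkeeping; 0 sorry; 0 def; imports `Gaps.CapSignsNecessary` (→ `Gaps.CapTailFloors` → `Beta.CapRowsTail`) and
`Gaps.CapTailSigns`; restates nothing of them.
-/

namespace Summit.QuantumFields.BalabanUV.Gaps.CapTailLimitNecessary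

open Literature.MathematicalPhysics.QuantumFieldTheory.Balaban1983to89
open Literature.MathematicalPhysics.QuantumFieldTheory.Balaban1983to89.FlowStep
open Literature.MathematicalPhysics.QuantumFieldTheory.Balaban1983to89.FlowStepRuns
open Literature.MathematicalPhysics.QuantumFieldTheory.Balaban1983to89.DagBinding
open Literature.MathematicalPhysics.QuantumFieldTheory.Balaban1983to89.Beta.RateCertificate (GeomRate)
open Summit.QuantumFields.BalabanUV.Beta.CapRowsTail (MonotoneTailUp MonotoneTailDown ContractingTail abs_sub_le_of_contractingTail)
open Summit.QuantumFields.BalabanUV.Gaps.CapSignsConstRoad (EverySlope everySlope_of_af1)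
open Summit.QuantumFields.BalabanUV.Gaps.CapSignsNecessary
open Filter
open scoped Topology

noncomputable section

variable {β : HBeta}

/-! ## §1 Pure bookkeeping: window means through a tail socket -/

/-- Window means `≥ c` (up to `A/n`) of a sequence EVENTUALLY dominated by `binf + d·θ^{j−k₀}` (`d ≥ 0`, `0 ≤ θ < 1`) force `c ≤ binf`: on the
windows `[k₀, k₀+n)` one gets `(c − binf)·n ≤ A + d/(1−θ)` for every `n`. [folklore] -/
theorem le_of_windowSum_lower_eventualUpper {b : ℕ → ℝ} {c A binf d θ : ℝ} {k₀ : ℕ}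
    (hw : ∀ k n : ℕ, c * n - A ≤ ∑ j ∈ Finset.Ico k (k + n), b j)
    (hd : 0 ≤ d) (hθ0 : 0 ≤ θ) (hθ1 : θ < 1) (hup : ∀ j, k₀ ≤ j → b j ≤ binf + d * θ ^ (j - k₀)) : c ≤ binf := by
  have hbound : ∀ n : ℕ, (c - binf) * n ≤ A + d / (1 - θ) := by
    intro n
    have h1 := hw k₀ n
    have h2 : ∑ j ∈ Finset.Ico k₀ (k₀ + n), b j ≤ ∑ j ∈ Finset.Ico k₀ (k₀ + n), (binf + d * θ ^ (j - k₀)) :=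
      Finset.sum_le_sum fun j hj => hup j (Finset.mem_Ico.mp hj).1
    have hθsum : ∑ j ∈ Finset.Ico k₀ (k₀ + n), θ ^ (j - k₀) = ∑ i ∈ Finset.range n, θ ^ i := by
      rw [Finset.sum_Ico_eq_sum_range]
      simp only [add_tsub_cancel_left]
    have h3 : ∑ i ∈ Finset.range n, θ ^ i ≤ 1 / (1 - θ) := by
      have h := geom_sum_Ico_le_of_lt_one hθ0 hθ1 (m := 0) (n := n)
      rw [pow_zero] at h
      rw [Finset.range_eq_Ico]
      exact h
    have hsplit : ∑ j ∈ Finset.Ico k₀ (k₀ + n), (binf + d * θ ^ (j - k₀)) = n * binf + d * ∑ i ∈ Finset.range n, θ ^ i := by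
      rw [Finset.sum_add_distrib, Finset.sum_const, Nat.card_Ico, ← Finset.mul_sum, hθsum,
        show k₀ + n - k₀ = n from by omega, nsmul_eq_mul]
    have h4 : d * ∑ i ∈ Finset.range n, θ ^ i ≤ d / (1 - θ) := by
      calc d * ∑ i ∈ Finset.range n, θ ^ i ≤ d * (1 / (1 - θ)) := mul_le_mul_of_nonneg_left h3 hd
        _ = d / (1 - θ) := by ring
    rw [hsplit] at h2
    have e : (c - binf) * n = c * n - n * binf := by ring
    rw [e]
    linarith
  refine le_of_not_gt fun hlt => ?_
  have hpos : 0 < c - binf := by linarith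
  obtain ⟨n, hn⟩ := exists_nat_gt ((A + d / (1 - θ)) / (c - binf))
  rw [div_lt_iff₀ hpos] at hn
  have := hbound n
  linarith

/-- A `GeomRate b binf c₀ θ` tail (`|b_k − binf| ≤ c₀θ^k`) is dominated by `binf + c₀·θ^{k−0}`, with `c₀ ≥ 0`. [folklore] -/
theorem eventualUpper_of_geomRate {b : ℕ → ℝ} {binf c₀ θ : ℝ} (hconv : GeomRate b binf c₀ θ) :
    0 ≤ c₀ ∧ ∀ j, 0 ≤ j → b j ≤ binf + c₀ * θ ^ (j - 0) := by
  refine ⟨hconv.const_nonneg, fun j _ => ?_⟩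
  have := (abs_le.mp (hconv j)).2
  simpa using by linarith

/-- RATE-FREE form: window means `≥ c` (up to `A/n`) of a CONVERGENT sequence force `c ≤ lim`: the Cesàro means converge to the limit
(`Filter.Tendsto.cesaro`) and dominate `c − A/n`. [folklore] -/
theorem le_lim_of_windowSum_lower_tendsto {b : ℕ → ℝ} {c A binf : ℝ}
    (hw : ∀ k n : ℕ, c * n - A ≤ ∑ j ∈ Finset.Ico k (k + n), b j)
    (hlim : Tendsto b atTop (𝓝 binf)) : c ≤ binf := by
  have hces := hlim.cesaro
  have hlow : Tendsto (fun n : ℕ => c - A * (n : ℝ)⁻¹) atTop (𝓝 c) := by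
    have h0 : Tendsto (fun n : ℕ => A * (n : ℝ)⁻¹) atTop (𝓝 0) := by
      simpa using tendsto_const_nhds.mul (tendsto_inv_atTop_nhds_zero_nat (𝕜 := ℝ))
    simpa using tendsto_const_nhds.sub h0
  refine le_of_tendsto_of_tendsto hlow hces ?_
  filter_upwards [eventually_ge_atTop 1] with n hn
  have hn' : (0 : ℝ) < n := by exact_mod_cast hn
  have h1 := hw 0 n
  rw [zero_add, ← Finset.range_eq_Ico] at h1
  rw [sub_le_iff_le_add]
  calc c = (n : ℝ)⁻¹ * (c * n) := by field_simp
    _ ≤ (n : ℝ)⁻¹ * (∑ j ∈ Finset.range n, b j + A) :=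
        mul_le_mul_of_nonneg_left (by linarith) (by positivity)
    _ = (n : ℝ)⁻¹ * ∑ i ∈ Finset.range n, b i + A * (n : ℝ)⁻¹ := by ring

/-- Syndetic positivity (`c ≤ b_j` somewhere in every window of length `n₀`) and an eventually NON-INCREASING tail from `k₀` give the eventual
floor `c ≤ b_k` for all `k ≥ k₀`. [folklore] -/
theorem eventualFloor_of_syndetic_monotoneTailDown {b : ℕ → ℝ} {c : ℝ} {n₀ k₀ : ℕ}
    (hs : ∀ k : ℕ, ∃ j ∈ Finset.Ico k (k + n₀), c ≤ b j) (hmono : MonotoneTailDown b k₀) :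
    ∀ k, k₀ ≤ k → c ≤ b k := by
  have hdown : ∀ k j, k₀ ≤ k → k ≤ j → b j ≤ b k := by
    intro k j hk hkj
    induction j, hkj using Nat.le_induction with
    | base => exact le_rfl
    | succ n hkn ih => exact (hmono n (hk.trans hkn)).trans ih
  intro k hk
  obtain ⟨j, hj, hcj⟩ := hs k
  exact hcj.trans (hdown k j hk (Finset.mem_Ico.mp hj).1)

/-- Syndetic positivity and an eventually NON-DECREASING tail from `k₀` give the eventual floor `c ≤ b_k` for all `k ≥ k₀ + n₀`. [folklore] -/
theorem eventualFloor_of_syndetic_monotoneTailUp {b : ℕ → ℝ} {c : ℝ} {n₀ k₀ : ℕ}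
    (hs : ∀ k : ℕ, ∃ j ∈ Finset.Ico k (k + n₀), c ≤ b j) (hmono : MonotoneTailUp b k₀) :
    ∀ k, k₀ + n₀ ≤ k → c ≤ b k := by
  have hup : ∀ j k, k₀ ≤ j → j ≤ k → b j ≤ b k := by
    intro j k hj hjk
    induction k, hjk using Nat.le_induction with
    | base => exact le_rfl
    | succ n hjn ih => exact ih.trans (hmono n (hj.trans hjn))
  intro k hk
  obtain ⟨j, hj, hcj⟩ := hs k₀
  obtain ⟨hj1, hj2⟩ := Finset.mem_Ico.mp hj
  exact hcj.trans (hup j k hj1 (by omega))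

/-! ## §2 Construction level: [I] Theorem 2 as printed through each tail socket (every-slope road) -/

/-- **A RATE FORCES A POSITIVE LIMIT VALUE.**  On the every-slope road, for a forward-generated construction (halting outside, curried) whose
one-loop coefficients converge geometrically, `GeomRate β⁰ binf c₀ θ` with `0 ≤ θ < 1` (the `LimitForm.conv` shape; producer G-an2-4, OPEN):
`B12.Thm2Printed C L` with `L > 1` forces `0 < binf`.  So `LimitForm.binf_pos` is a NECESSARY field, not a convenience: a certified
`β⁰_∞ ≤ 0` would refute (0.31) for every such construction. [cite: Balaban1987RG1, Thm 2 (0.31) p.259] -/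
theorem binf_pos_of_thm2Printed_geomRate {C : B12.Construction} (hgen : ForwardGenerated C β) (hhalt : HaltsOutside C β)
    (hcur : CurriesHBeta C β) (S : B12Beta.OneLoopSplit β) {γc : ℝ} (hrem : EverySlope S γc) {binf c₀ θ : ℝ}
    (hconv : GeomRate S.β0 binf c₀ θ) (hθ0 : 0 ≤ θ) (hθ1 : θ < 1) {L : ℝ} (hL : 1 < L) (h : B12.Thm2Printed C L) :
    0 < binf := by
  obtain ⟨c, hc, A, hw⟩ := beta0_windowSum_lower_of_thm2Printed hgen hhalt hcur S hrem hL h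
  obtain ⟨hc₀, hup⟩ := eventualUpper_of_geomRate hconv
  exact hc.trans_le (le_of_windowSum_lower_eventualUpper hw hc₀ hθ0 hθ1 hup)

/-- **A RATE FORCES AN EVENTUAL FLOOR.**  Same hypotheses: `B12.Thm2Printed C L` forces an eventual positive floor `binf/2 ≤ β⁰_{k+1}` from some
`k₀` (`binf > 0` by `binf_pos_of_thm2Printed_geomRate`, then `CapTailFloors.eventualFloor_of_geomRate`).  With a rate socket the necessary and
the sufficient tail currency of `Gaps/CapTailFloors` (eventual floor ⟹ END; + signs ⟹ (0.31)) MEET. [cite: Balaban1987RG1, Thm 2 (0.31) p.259] -/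
theorem eventualFloor_of_thm2Printed_geomRate {C : B12.Construction} (hgen : ForwardGenerated C β) (hhalt : HaltsOutside C β)
    (hcur : CurriesHBeta C β) (S : B12Beta.OneLoopSplit β) {γc : ℝ} (hrem : EverySlope S γc) {binf c₀ θ : ℝ}
    (hconv : GeomRate S.β0 binf c₀ θ) (hθ0 : 0 ≤ θ) (hθ1 : θ < 1) {L : ℝ} (hL : 1 < L) (h : B12.Thm2Printed C L) :
    0 < binf ∧ ∃ k₀ : ℕ, ∀ k, k₀ ≤ k → binf / 2 ≤ S.β0 k :=
  have hb := binf_pos_of_thm2Printed_geomRate hgen hhalt hcur S hrem hconv hθ0 hθ1 hL h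
  ⟨hb, CapTailFloors.eventualFloor_of_geomRate hconv hθ0 hθ1 hb⟩

/-- **RATE-FREE: A LIMIT FORCES ITS OWN POSITIVITY AND AN EVENTUAL FLOOR.**  On the every-slope road, if the one-loop coefficients merely
CONVERGE, `β⁰_{k+1} → β⁰_∞` (`Filter.Tendsto S.β0 atTop (𝓝 binf)`; no rate, no monotonicity), then `B12.Thm2Printed C L` (`L > 1`) forces
`0 < β⁰_∞` and `β⁰_∞/2 ≤ β⁰_{k+1}` from some `k₀` on.  So for a CONVERGENT one-loop sequence the eventual floor of `Gaps/CapTailFloors` is NECESSARY,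
and the alternating witness of `Gaps/CapFloorNotNecessary` is possible only because its `β⁰` does not converge. [cite: Balaban1987RG1, Thm 2 (0.31) p.259] -/
theorem eventualFloor_of_thm2Printed_tendsto {C : B12.Construction} (hgen : ForwardGenerated C β) (hhalt : HaltsOutside C β)
    (hcur : CurriesHBeta C β) (S : B12Beta.OneLoopSplit β) {γc : ℝ} (hrem : EverySlope S γc) {binf : ℝ}
    (hlim : Tendsto S.β0 atTop (𝓝 binf)) {L : ℝ} (hL : 1 < L) (h : B12.Thm2Printed C L) :
    0 < binf ∧ ∃ k₀ : ℕ, ∀ k, k₀ ≤ k → binf / 2 ≤ S.β0 k := by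
  obtain ⟨c, hc, A, hw⟩ := beta0_windowSum_lower_of_thm2Printed hgen hhalt hcur S hrem hL h
  have hb : 0 < binf := hc.trans_le (le_lim_of_windowSum_lower_tendsto hw hlim)
  have hev : ∀ᶠ k in atTop, S.β0 k ∈ Set.Ioi (binf / 2) := hlim.eventually (Ioi_mem_nhds (by linarith))
  obtain ⟨k₀, hk₀⟩ := eventually_atTop.mp hev
  exact ⟨hb, k₀, fun k hk => (Set.mem_Ioi.mp (hk₀ k hk)).le⟩

/-- **A CONTRACTION FORCES A POSITIVE LIMIT VALUE AND AN EVENTUAL FLOOR.**  Socket (C) `CapRowsTail.ContractingTail β⁰ binf θ k₀` with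
`0 ≤ θ < 1` (producer gan24-p4 Loewner ∕ asym1, OPEN): `B12.Thm2Printed C L` (`L > 1`, every-slope road) forces `0 < binf` (window means against
the decay `|β⁰_{k+1} − binf| ≤ θ^{k−k₀}|β⁰_{k₀+1} − binf|`, `CapRowsTail.abs_sub_le_of_contractingTail`) and then an eventual floor `binf/2 ≤ β⁰_{k+1}`.
[cite: Balaban1987RG1, Thm 2 (0.31) p.259] -/
theorem eventualFloor_of_thm2Printed_contractingTail {C : B12.Construction} (hgen : ForwardGenerated C β) (hhalt : HaltsOutside C β)
    (hcur : CurriesHBeta C β) (S : B12Beta.OneLoopSplit β) {γc : ℝ} (hrem : EverySlope S γc) {binf θ : ℝ} {k₀ : ℕ}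
    (hct : ContractingTail S.β0 binf θ k₀) (hθ0 : 0 ≤ θ) (hθ1 : θ < 1) {L : ℝ} (hL : 1 < L) (h : B12.Thm2Printed C L) :
    0 < binf ∧ ∃ k₁ : ℕ, ∀ k, k₁ ≤ k → binf / 2 ≤ S.β0 k := by
  obtain ⟨c, hc, A, hw⟩ := beta0_windowSum_lower_of_thm2Printed hgen hhalt hcur S hrem hL h
  set d : ℝ := |S.β0 k₀ - binf| with hd
  have hd0 : 0 ≤ d := abs_nonneg _
  have hup : ∀ j, k₀ ≤ j → S.β0 j ≤ binf + d * θ ^ (j - k₀) := by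
    intro j hj
    have h1 := abs_sub_le_of_contractingTail hct hθ0 j hj
    have h2 := (abs_le.mp (h1.trans_eq (mul_comm _ _))).2
    linarith
  have hb : 0 < binf := hc.trans_le (le_of_windowSum_lower_eventualUpper hw hd0 hθ0 hθ1 hup)
  refine ⟨hb, ?_⟩
  -- geometric decay of the deviation beyond k₀ gives the floor binf/2 eventually
  obtain ⟨m, hm⟩ := exists_pow_lt_of_lt_one (show 0 < binf / (2 * (d + 1)) by positivity) hθ1
  refine ⟨k₀ + m, fun k hk => ?_⟩
  have h1 := abs_sub_le_of_contractingTail hct hθ0 k (by omega)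
  have h2 := (abs_le.mp h1).1
  have h3 : θ ^ (k - k₀) ≤ θ ^ m := pow_le_pow_of_le_one hθ0 hθ1.le (by omega)
  have h4 : θ ^ (k - k₀) * d ≤ (d + 1) * θ ^ m := by nlinarith [pow_nonneg hθ0 (k - k₀)]
  have h5 : (d + 1) * θ ^ m ≤ (d + 1) * (binf / (2 * (d + 1))) := mul_le_mul_of_nonneg_left hm.le (by linarith)
  have h6 : (d + 1) * (binf / (2 * (d + 1))) = binf / 2 := by field_simp
  linarith

/-- **AN EVENTUALLY NON-INCREASING TAIL FORCES AN EVENTUAL FLOOR.**  Socket (M↓) `CapRowsTail.MonotoneTailDown β⁰ k₀` (no limit value, no rate):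
on the every-slope road `B12.Thm2Printed C L` (`L > 1`) forces `∃ f > 0, ∀ k ≥ k₀, f ≤ β⁰_{k+1}` — syndetic positivity
(`CapSignsNecessary.beta0_syndeticPos_of_thm2Printed`) propagated downwards by monotonicity. [cite: Balaban1987RG1, Thm 2 (0.31) p.259] -/
theorem eventualFloor_of_thm2Printed_monotoneTailDown {C : B12.Construction} (hgen : ForwardGenerated C β) (hhalt : HaltsOutside C β)
    (hcur : CurriesHBeta C β) (S : B12Beta.OneLoopSplit β) {γc : ℝ} (hrem : EverySlope S γc) {k₀ : ℕ}
    (hmono : MonotoneTailDown S.β0 k₀) {L : ℝ} (hL : 1 < L) (h : B12.Thm2Printed C L) :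
    ∃ f : ℝ, 0 < f ∧ ∀ k, k₀ ≤ k → f ≤ S.β0 k := by
  obtain ⟨c, hc, n₀, -, hs⟩ := beta0_syndeticPos_of_thm2Printed hgen hhalt hcur S hrem hL h
  exact ⟨c, hc, eventualFloor_of_syndetic_monotoneTailDown hs hmono⟩

/-- **AN EVENTUALLY NON-DECREASING TAIL FORCES AN EVENTUAL FLOOR.**  Socket (M↑) `CapRowsTail.MonotoneTailUp β⁰ k₀`: on the every-slope road
`B12.Thm2Printed C L` (`L > 1`) forces `∃ f > 0, ∃ k₁, ∀ k ≥ k₁, f ≤ β⁰_{k+1}` (`k₁ = k₀ + n₀`, `n₀` the syndetic window length).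
[cite: Balaban1987RG1, Thm 2 (0.31) p.259] -/
theorem eventualFloor_of_thm2Printed_monotoneTailUp {C : B12.Construction} (hgen : ForwardGenerated C β) (hhalt : HaltsOutside C β)
    (hcur : CurriesHBeta C β) (S : B12Beta.OneLoopSplit β) {γc : ℝ} (hrem : EverySlope S γc) {k₀ : ℕ}
    (hmono : MonotoneTailUp S.β0 k₀) {L : ℝ} (hL : 1 < L) (h : B12.Thm2Printed C L) :
    ∃ f : ℝ, 0 < f ∧ ∃ k₁ : ℕ, ∀ k, k₁ ≤ k → f ≤ S.β0 k := by
  obtain ⟨c, hc, n₀, -, hs⟩ := beta0_syndeticPos_of_thm2Printed hgen hhalt hcur S hrem hL h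
  exact ⟨c, hc, k₀ + n₀, eventualFloor_of_syndetic_monotoneTailUp hs hmono⟩

/-! ## §3 On the limit-form road, off the boundary: (0.31) ⟺ the CAP sign list -/

/-- **[I] THEOREM 2 AS PRINTED ⟺ THE CAP SIGN LIST, on the limit-form road off the boundary.**  For the β sub-cell's carrier
`D : Beta.Assembly.LimitForm β` (split + (AF-0∞) `binf > 0` + (AF-0r) rate + (AF-1) + (C) + (U); every field but (U) a located UNPRINTED input of
rows an1–an4), a forward-generated construction (halting outside, curried) and `L > 1`: if no early coefficient vanishes EXACTLY
(`β⁰_{k+1} ≠ 0` for `k < k₀`, `k₀ = D.k₀` the tail index set by the rate), then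
`B12.Thm2Printed C L ↔ ∀ k < k₀, 0 < β⁰_{k+1}`.
`→`: (N1) `CapSignsNecessary.beta0_nonneg_of_thm2Printed_limitForm` + non-vanishing; `←`: gen 0's `CapTailSigns.thm2Printed_of_signs`.  So, GIVEN THE
TAIL in limit form, the (0.31) row's residue IS the CAP sign list — exactly what certified numerics at the construction's `L` decide (b2b row
CAP-k; 0 coefficients certified to date). [cite: Balaban1987RG1, Thm 2 (0.31) p.259] -/
theorem thm2Printed_iff_signs_of_limitForm (D : Beta.Assembly.LimitForm β) {C : B12.Construction} (hgen : ForwardGenerated C β)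
    (hhalt : HaltsOutside C β) (hcur : CurriesHBeta C β) {L : ℝ} (hL : 1 < L) (hne : ∀ k, k < D.k₀ → D.S.β0 k ≠ 0) :
    B12.Thm2Printed C L ↔ ∀ k, k < D.k₀ → 0 < D.S.β0 k :=
  ⟨fun h k hk => lt_of_le_of_ne (beta0_nonneg_of_thm2Printed_limitForm D hgen hhalt hcur hL h k) (hne k hk).symm,
    fun hsign => CapTailSigns.thm2Printed_of_signs D hgen hL hsign⟩

/-- The same with the boundary excluded at EVERY scale (`β⁰_{k+1} ≠ 0` for all `k`): `B12.Thm2Printed C L ↔ ∀ k, 0 < β⁰_{k+1}` on the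
limit-form road — the full sign list (the tail's part of it is automatic from the rate, `LimitForm.beta0_pos_of_le`). [cite: Balaban1987RG1, Thm 2 (0.31) p.259] -/
theorem thm2Printed_iff_allSigns_of_limitForm (D : Beta.Assembly.LimitForm β) {C : B12.Construction} (hgen : ForwardGenerated C β)
    (hhalt : HaltsOutside C β) (hcur : CurriesHBeta C β) {L : ℝ} (hL : 1 < L) (hne : ∀ k, D.S.β0 k ≠ 0) :
    B12.Thm2Printed C L ↔ ∀ k, 0 < D.S.β0 k :=
  ⟨fun h k => lt_of_le_of_ne (beta0_nonneg_of_thm2Printed_limitForm D hgen hhalt hcur hL h k) (hne k).symm,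
    fun hsign => CapTailSigns.thm2Printed_of_signs D hgen hL fun k _ => hsign k⟩

/-! ## §4 Rate-free exact residue under mere convergence: (0.31) ⟺ all signs ∧ a positive limit -/

/-- A sequence with ALL terms positive converging to a POSITIVE limit has a uniform positive floor (`min` of the finite prefix and `binf/2`).
[folklore] -/
theorem floor_of_allSigns_tendsto {b : ℕ → ℝ} {binf : ℝ} (hpos : ∀ k, 0 < b k) (hlim : Tendsto b atTop (𝓝 binf))
    (hbinf : 0 < binf) : ∃ f : ℝ, 0 < f ∧ ∀ k, f ≤ b k := by
  obtain ⟨k₀, hk₀⟩ := eventually_atTop.mp (hlim.eventually (Ioi_mem_nhds (half_lt_self hbinf)))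
  obtain ⟨m₀, hm₀, hm⟩ := CapSignsConstRoad.exists_pos_floor_of_signs b k₀ fun k _ => hpos k
  refine ⟨min m₀ (binf / 2), lt_min hm₀ (half_pos hbinf), fun k => ?_⟩
  rcases lt_or_ge k k₀ with hk | hk
  · exact (min_le_left _ _).trans (hm k hk)
  · exact (min_le_right _ _).trans (Set.mem_Ioi.mp (hk₀ k hk)).le

/-- **RATE-FREE SUFFICIENCY**: all signs `0 < β⁰_{k+1}`, convergence of `β⁰` to a POSITIVE limit (no rate constants, no index `k₀`), `EverySlope`,
(C), (U), forward generation, `L > 1` ⟹ `B12.Thm2Printed C L` (uniform floor from `floor_of_allSigns_tendsto`, then gen 2's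
`CapSignsConstRoad.thm2Printed_of_beta0Floor_everySlope`). [cite: Balaban1987RG1, Thm 2 (0.31) p.259] -/
theorem thm2Printed_of_allSigns_tendsto {C : B12.Construction} (hgen : ForwardGenerated C β) {L : ℝ} (hL : 1 < L)
    (S : B12Beta.OneLoopSplit β) {γc β' binf : ℝ} (hpos : ∀ k, 0 < S.β0 k) (hlim : Tendsto S.β0 atTop (𝓝 binf))
    (hbinf : 0 < binf) (hrem : EverySlope S γc) (hcont : BetaContH γc β) (hup : BetaUpperH β' γc β) :
    B12.Thm2Printed C L := by
  obtain ⟨f, hf, hF⟩ := floor_of_allSigns_tendsto hpos hlim hbinf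
  exact CapSignsConstRoad.thm2Printed_of_beta0Floor_everySlope hgen hL S hf hF hrem hcont hup

/-- **THE RATE-FREE EXACT RESIDUE OF (0.31)**: on the every-slope road with (C), (U), for one-loop coefficients that merely CONVERGE (to an
unprescribed `binf`), off the boundary (`β⁰_{k+1} ≠ 0` for all `k`), for a forward-generated construction (halting outside, curried) and `L > 1`:
`B12.Thm2Printed C L ↔ (∀ k, 0 < β⁰_{k+1}) ∧ 0 < binf`.
`→`: (N1) + `eventualFloor_of_thm2Printed_tendsto`; `←`: `thm2Printed_of_allSigns_tendsto`.  So given convergence (row tail ∕ G-an2-4 in its weakest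
form) the (0.31) row IS «all signs + positive limit» — the CAP list extended to every scale plus `β⁰_∞ > 0`; with a RATE the list shrinks to `k < k₀`
(`thm2Printed_iff_signs_of_limitForm`). [cite: Balaban1987RG1, Thm 2 (0.31) p.259] -/
theorem thm2Printed_iff_allSigns_and_limit_pos {C : B12.Construction} (hgen : ForwardGenerated C β) (hhalt : HaltsOutside C β)
    (hcur : CurriesHBeta C β) (S : B12Beta.OneLoopSplit β) {γc β' binf : ℝ} (hlim : Tendsto S.β0 atTop (𝓝 binf))
    (hrem : EverySlope S γc) (hcont : BetaContH γc β) (hup : BetaUpperH β' γc β) {L : ℝ} (hL : 1 < L) (hne : ∀ k, S.β0 k ≠ 0) :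
    B12.Thm2Printed C L ↔ (∀ k, 0 < S.β0 k) ∧ 0 < binf :=
  ⟨fun h => ⟨fun k => lt_of_le_of_ne (beta0_nonneg_of_thm2Printed_everySlope hgen hhalt hcur S hrem hL h k) (hne k).symm,
      (eventualFloor_of_thm2Printed_tendsto hgen hhalt hcur S hrem hlim hL h).1⟩,
    fun h => thm2Printed_of_allSigns_tendsto hgen hL S h.1 hlim h.2 hrem hcont hup⟩

end

end Summit.QuantumFields.BalabanUV.Gaps.CapTailLimitNecessary
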